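import Summits.BirchSwinnertonDyer.BirchSwinnertonDyer.Theorems.Rank1ResidualJetCarrierMultKitOrder
import Summits.BirchSwinnertonDyer.BirchSwinnertonDyer.Theorems.Rank1ResidualJetCarrierAddKit
import HarnessLib

/-!
# T1 JET (cell `bsd-jet`), bucket B of `JET@p∣N`: by-name SAMPLE ROWS for the forthcoming
# OFFER-JET-DOCSTRIKE-BUCKET-B (director-bsd 2026-08-27T02:36:54Z «pre-stage»; referee C R416 grammar) —
# file 3 of 3: B-mult at p ≥ 5, roads S, O, R, 8 cells

HONEST FRAMING (programme file §HONESTY, verbatim): «no tranche here proves BSD; ARM L moves the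
LITERAL column of an r ≤ 1 census into the kernel-proved-modulo-named-print column.» THEOREMS ONLY
(seat `bsd-jet-pv-2`, session g2; `--supports stmt-BirchSwinnertonDyer-14418`, helper). Each record is
`BSDp W p` for one census cell of `HOME/census-jet/jet_keys_B_classes.tsv` 4c8599cf93bc5459 through the
landed kits (`Rank1ResidualJetCarrierMultKit.lean` p465088, `…MultKitOrder.lean` p474328,
`…CarrierAddKit.lean` p475627), with every numeric hypothesis (`Δ ≠ 0`, the support-form Kraus
certificate, reduction type at `p`, the image witnesses) re-verified by `decide`/`norm_num` in the
kernel from the kit witness tables `HOME/sheets/pv2-B3-witness/` (j262920) and `pv2-B5-witness/`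
(j263826); the READING binder (`JET.JetchevDivisibilityCarrierMult` = K3 or `…CarrierAdd` = K4,
referee C R385/R416: GAPPED-in-print, gap closed BY NAME), the published binders, the Heegner datum,
the index line at the carrier and `#Ш_an` stay DISPLAYED. The stratified sample (road × p × Kodaira
type × rank) is the bucket-B analogue of the 55-row DOCSTRIKE-A sample (ty, JetDocstrikeARecords01–07).
CONDITIONAL; nothing is booked by this file; 0 classes move.
References: [Jetchev2008] Cor. 1.5; [Cremona2006] Table 1; [Serre1972] §2.4 Prop. 15, §2.8 Prop. 19;
[Kraus1989] Prop. 1–2; [Wuthrich2014] Lemma 20; [Elkies2006] (mod-9 tower witness).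
-/

set_option autoImplicit false

noncomputable section

open scoped Classical

open WeierstrassCurve Literature.NumberTheory.EllipticCurves
  Literature.NumberTheory.EllipticCurves.ModularForms
  Literature.NumberTheory.EllipticCurves.Rank1Residual
  Literature.NumberTheory.EllipticCurves.Rank1Residual.X11RankOneCertificates
  Summit.BirchSwinnertonDyer.BirchSwinnertonDyer.Rank1Residual
  Summit.BirchSwinnertonDyer.BirchSwinnertonDyer.Rank1Residual.IntModel
  Summit.BirchSwinnertonDyer.BirchSwinnertonDyer.Rank1Residual.X11RankOne
  Summit.BirchSwinnertonDyer.Rank1Residual Summit.BirchSwinnertonDyer.Rank1Residual.X11b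

namespace Summit.BirchSwinnertonDyer.Rank1Residual.JET

/-- **`BSD(E,5)` for `530c1`, bucket B-mult at `p = 5 ≥ 5`, road S** (`N = 530`, `r = 1`, split
`I10` at `5`, `c_5 = 10`, `D = -271`; model `[1,-1,0,1226,30580]`, `Δ = -530000000000`, support
`2:10;5:10;53:1`): kit `JET.bsdp_of_jetRowCarrierMult_of_serreWitnesses` with Serre's Prop. 19 triple: `(7, 10)` split
(non-zero square discriminant), `(3, 7)` non-split, `(3, 7)` with `u = 3` (kit table
`HOME/sheets/pv2-B5-witness/witness_B_p5plus.tsv`, job j263826). Displayed binders: `hJ` (READING K3), the published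
`hMcU` … `hlev`, the Heegner datum and the index line at the carrier `5`. CONDITIONAL; nothing booked.
[cite: Jetchev2008, Cor. 1.5 (p. 812)] [cite: Cremona2006, Table 1 (label 530c1)] [cite: Serre1972, §2.8 Prop. 19] -/
theorem bsdp_jetBmult_530c1_5_serre
    (hJ : JetchevDivisibilityCarrierMult)
    (hMcU : McCallum1991_padicValNat_card_sha_primary_add_le_of_globalDivisibility)
    (hGZK : rank_eq_analyticRank_of_analyticRank_le_one)
    (hKo : ∀ (N : ℕ) [NeZero N] (W : WeierstrassCurve ℚ) (K : Type) [Field K] [NumberField K],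
      kolyvagin N W K)
    (hrec : ∀ (N : ℕ) [NeZero N] (W : WeierstrassCurve ℚ) (K : Type) [Field K] [NumberField K],
      heegnerPointOfConductor_one_galoisConj N W K)
    (hD36 : ∀ (N : ℕ) [NeZero N] (W : WeierstrassCurve ℚ) (K : Type) [Field K] [NumberField K],
      phi_heegnerTau_mem_singularModuliField N W K)
    (hlev : ∀ {N : ℕ} [NeZero N], IsNewformOf.level_eq_conductorNorm (N := N))
    (W : WeierstrassCurve ℚ) (hW : W = ⟨1, (-1), 0, 1226, 30580⟩)
    {N : ℕ} [NeZero N] {K : Type} [Field K] [NumberField K] (hK : IsImaginaryQuadratic K)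
    (hD3 : NumberField.discr K ≠ -3) (hD4 : NumberField.discr K ≠ -4)
    (hH : SatisfiesHeegnerHypothesis N K) {P : (W.baseChange K).toAffine.Point}
    (hP : IsHeegnerPoint N W K P) (hnt : ¬ IsOfFinAddOrder P)
    (hI : padicValNat 5 (AddSubgroup.zmultiples P).index ≤
      padicValNat 5 ((W.baseChange ℚ_[5]).localTamagawaNumber ℤ_[5]))
    (hr : W.analyticRank ≤ 1) {s : ℚ} (hs : shaAn W = (s : ℂ)) (hv : padicValRat 5 s = 0) :
    BSDp W 5 :=
  bsdp_of_jetRowCarrierMult_of_serreWitnesses 5 Nat.prime_five (by norm_num) 1 (-1) 0 1226 30580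
    (by decide +kernel) [(2, 1, 10), (5, 1, 10), (53, 1, 1)]
    (by intro t ht; simp only [List.mem_cons, List.not_mem_nil, or_false] at ht
        rcases ht with rfl | rfl | rfl <;> norm_num)
    (by decide +kernel) (by decide +kernel) (by decide +kernel) (by decide +kernel)
    7 3 3 (by norm_num) (by norm_num) (by norm_num) (by norm_num) (by norm_num) (by norm_num)
    (by norm_num) (by norm_num) (by norm_num) (by decide +kernel) (by decide +kernel) (by decide +kernel)
    (n₁ := 10) (n₂ := 7) (n₃ := 7) (by decide +kernel) (by decide +kernel) (by decide +kernel)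
    (by decide +kernel) (by decide +kernel) (by decide +kernel) hJ hMcU hGZK hKo hrec hD36 hlev W hW hK
    hD3 hD4 hH hP hnt hI hr hs hv

/-- **`BSD(E,5)` for `605a1`, bucket B-mult at `p = 5 ≥ 5`, road S** (`N = 605`, `r = 1`, split
`I5` at `5`, `c_5 = 5`, `D = -19`; model `[1,-1,0,-1414,-44027]`, `Δ = -669871503125`, support
`5:5;11:8`): kit `JET.bsdp_of_jetRowCarrierMult_of_serreWitnesses` with Serre's Prop. 19 triple: `(7, 5)` split
(non-zero square discriminant), `(3, 7)` non-split, `(3, 7)` with `u = 3` (kit table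
`HOME/sheets/pv2-B5-witness/witness_B_p5plus.tsv`, job j263826). Displayed binders: `hJ` (READING K3), the published
`hMcU` … `hlev`, the Heegner datum and the index line at the carrier `5`. CONDITIONAL; nothing booked.
[cite: Jetchev2008, Cor. 1.5 (p. 812)] [cite: Cremona2006, Table 1 (label 605a1)] [cite: Serre1972, §2.8 Prop. 19] -/
theorem bsdp_jetBmult_605a1_5_serre
    (hJ : JetchevDivisibilityCarrierMult)
    (hMcU : McCallum1991_padicValNat_card_sha_primary_add_le_of_globalDivisibility)
    (hGZK : rank_eq_analyticRank_of_analyticRank_le_one)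
    (hKo : ∀ (N : ℕ) [NeZero N] (W : WeierstrassCurve ℚ) (K : Type) [Field K] [NumberField K],
      kolyvagin N W K)
    (hrec : ∀ (N : ℕ) [NeZero N] (W : WeierstrassCurve ℚ) (K : Type) [Field K] [NumberField K],
      heegnerPointOfConductor_one_galoisConj N W K)
    (hD36 : ∀ (N : ℕ) [NeZero N] (W : WeierstrassCurve ℚ) (K : Type) [Field K] [NumberField K],
      phi_heegnerTau_mem_singularModuliField N W K)
    (hlev : ∀ {N : ℕ} [NeZero N], IsNewformOf.level_eq_conductorNorm (N := N))
    (W : WeierstrassCurve ℚ) (hW : W = ⟨1, (-1), 0, (-1414), (-44027)⟩)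
    {N : ℕ} [NeZero N] {K : Type} [Field K] [NumberField K] (hK : IsImaginaryQuadratic K)
    (hD3 : NumberField.discr K ≠ -3) (hD4 : NumberField.discr K ≠ -4)
    (hH : SatisfiesHeegnerHypothesis N K) {P : (W.baseChange K).toAffine.Point}
    (hP : IsHeegnerPoint N W K P) (hnt : ¬ IsOfFinAddOrder P)
    (hI : padicValNat 5 (AddSubgroup.zmultiples P).index ≤
      padicValNat 5 ((W.baseChange ℚ_[5]).localTamagawaNumber ℤ_[5]))
    (hr : W.analyticRank ≤ 1) {s : ℚ} (hs : shaAn W = (s : ℂ)) (hv : padicValRat 5 s = 0) :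
    BSDp W 5 :=
  bsdp_of_jetRowCarrierMult_of_serreWitnesses 5 Nat.prime_five (by norm_num) 1 (-1) 0 (-1414) (-44027)
    (by decide +kernel) [(5, 1, 5), (11, 2, 8)]
    (by intro t ht; simp only [List.mem_cons, List.not_mem_nil, or_false] at ht
        rcases ht with rfl | rfl <;> norm_num)
    (by decide +kernel) (by decide +kernel) (by decide +kernel) (by decide +kernel)
    7 3 3 (by norm_num) (by norm_num) (by norm_num) (by norm_num) (by norm_num) (by norm_num)
    (by norm_num) (by norm_num) (by norm_num) (by decide +kernel) (by decide +kernel) (by decide +kernel)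
    (n₁ := 5) (n₂ := 7) (n₃ := 7) (by decide +kernel) (by decide +kernel) (by decide +kernel)
    (by decide +kernel) (by decide +kernel) (by decide +kernel) hJ hMcU hGZK hKo hrec hD36 hlev W hW hK
    hD3 hD4 hH hP hnt hI hr hs hv

/-- **`BSD(E,7)` for `3752l1`, bucket B-mult at `p = 7 ≥ 5`, road S** (`N = 3752`, `r = 1`, split
`I7` at `7`, `c_7 = 7`, `D = -311`; model `[0,1,0,-13196,579056]`, `Δ = 14125409536`, support
`2:8;7:7;67:1`): kit `JET.bsdp_of_jetRowCarrierMult_of_serreWitnesses` with Serre's Prop. 19 triple: `(5, 7)` split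
(non-zero square discriminant), `(3, 3)` non-split, `(3, 3)` with `u = 5` (kit table
`HOME/sheets/pv2-B5-witness/witness_B_p5plus.tsv`, job j263826). Displayed binders: `hJ` (READING K3), the published
`hMcU` … `hlev`, the Heegner datum and the index line at the carrier `7`. CONDITIONAL; nothing booked.
[cite: Jetchev2008, Cor. 1.5 (p. 812)] [cite: Cremona2006, Table 1 (label 3752l1)] [cite: Serre1972, §2.8 Prop. 19] -/
theorem bsdp_jetBmult_3752l1_7_serre
    (hJ : JetchevDivisibilityCarrierMult)
    (hMcU : McCallum1991_padicValNat_card_sha_primary_add_le_of_globalDivisibility)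
    (hGZK : rank_eq_analyticRank_of_analyticRank_le_one)
    (hKo : ∀ (N : ℕ) [NeZero N] (W : WeierstrassCurve ℚ) (K : Type) [Field K] [NumberField K],
      kolyvagin N W K)
    (hrec : ∀ (N : ℕ) [NeZero N] (W : WeierstrassCurve ℚ) (K : Type) [Field K] [NumberField K],
      heegnerPointOfConductor_one_galoisConj N W K)
    (hD36 : ∀ (N : ℕ) [NeZero N] (W : WeierstrassCurve ℚ) (K : Type) [Field K] [NumberField K],
      phi_heegnerTau_mem_singularModuliField N W K)
    (hlev : ∀ {N : ℕ} [NeZero N], IsNewformOf.level_eq_conductorNorm (N := N))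
    (W : WeierstrassCurve ℚ) (hW : W = ⟨0, 1, 0, (-13196), 579056⟩)
    {N : ℕ} [NeZero N] {K : Type} [Field K] [NumberField K] (hK : IsImaginaryQuadratic K)
    (hD3 : NumberField.discr K ≠ -3) (hD4 : NumberField.discr K ≠ -4)
    (hH : SatisfiesHeegnerHypothesis N K) {P : (W.baseChange K).toAffine.Point}
    (hP : IsHeegnerPoint N W K P) (hnt : ¬ IsOfFinAddOrder P)
    (hI : padicValNat 7 (AddSubgroup.zmultiples P).index ≤
      padicValNat 7 ((W.baseChange ℚ_[7]).localTamagawaNumber ℤ_[7]))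
    (hr : W.analyticRank ≤ 1) {s : ℚ} (hs : shaAn W = (s : ℂ)) (hv : padicValRat 7 s = 0) :
    BSDp W 7 :=
  bsdp_of_jetRowCarrierMult_of_serreWitnesses 7 (by norm_num : Nat.Prime 7) (by norm_num) 0 1 0 (-13196) 579056
    (by decide +kernel) [(2, 3, 8), (7, 1, 7), (67, 1, 1)]
    (by intro t ht; simp only [List.mem_cons, List.not_mem_nil, or_false] at ht
        rcases ht with rfl | rfl | rfl <;> norm_num)
    (by decide +kernel) (by decide +kernel) (by decide +kernel) (by decide +kernel)
    5 3 3 (by norm_num) (by norm_num) (by norm_num) (by norm_num) (by norm_num) (by norm_num)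
    (by norm_num) (by norm_num) (by norm_num) (by decide +kernel) (by decide +kernel) (by decide +kernel)
    (n₁ := 7) (n₂ := 3) (n₃ := 3) (by decide +kernel) (by decide +kernel) (by decide +kernel)
    (by decide +kernel) (by decide +kernel) (by decide +kernel) hJ hMcU hGZK hKo hrec hD36 hlev W hW hK
    hD3 hD4 hH hP hnt hI hr hs hv

/-- **`BSD(E,11)` for `12067d1`, bucket B-mult at `p = 11 ≥ 5`, road S** (`N = 12067`, `r = 1`, split
`I11` at `11`, `c_11 = 11`, `D = -8`; model `[1,1,0,1070449,-830313724]`, `Δ = -376651255543489250203`, support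
`11:11;1097:3`): kit `JET.bsdp_of_jetRowCarrierMult_of_serreWitnesses` with Serre's Prop. 19 triple: `(3, 2)` split
(non-zero square discriminant), `(5, 8)` non-split, `(5, 8)` with `u = 3` (kit table
`HOME/sheets/pv2-B5-witness/witness_B_p5plus.tsv`, job j263826). Displayed binders: `hJ` (READING K3), the published
`hMcU` … `hlev`, the Heegner datum and the index line at the carrier `11`. CONDITIONAL; nothing booked.
[cite: Jetchev2008, Cor. 1.5 (p. 812)] [cite: Cremona2006, Table 1 (label 12067d1)] [cite: Serre1972, §2.8 Prop. 19] -/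
theorem bsdp_jetBmult_12067d1_11_serre
    (hJ : JetchevDivisibilityCarrierMult)
    (hMcU : McCallum1991_padicValNat_card_sha_primary_add_le_of_globalDivisibility)
    (hGZK : rank_eq_analyticRank_of_analyticRank_le_one)
    (hKo : ∀ (N : ℕ) [NeZero N] (W : WeierstrassCurve ℚ) (K : Type) [Field K] [NumberField K],
      kolyvagin N W K)
    (hrec : ∀ (N : ℕ) [NeZero N] (W : WeierstrassCurve ℚ) (K : Type) [Field K] [NumberField K],
      heegnerPointOfConductor_one_galoisConj N W K)
    (hD36 : ∀ (N : ℕ) [NeZero N] (W : WeierstrassCurve ℚ) (K : Type) [Field K] [NumberField K],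
      phi_heegnerTau_mem_singularModuliField N W K)
    (hlev : ∀ {N : ℕ} [NeZero N], IsNewformOf.level_eq_conductorNorm (N := N))
    (W : WeierstrassCurve ℚ) (hW : W = ⟨1, 1, 0, 1070449, (-830313724)⟩)
    {N : ℕ} [NeZero N] {K : Type} [Field K] [NumberField K] (hK : IsImaginaryQuadratic K)
    (hD3 : NumberField.discr K ≠ -3) (hD4 : NumberField.discr K ≠ -4)
    (hH : SatisfiesHeegnerHypothesis N K) {P : (W.baseChange K).toAffine.Point}
    (hP : IsHeegnerPoint N W K P) (hnt : ¬ IsOfFinAddOrder P)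
    (hI : padicValNat 11 (AddSubgroup.zmultiples P).index ≤
      padicValNat 11 ((W.baseChange ℚ_[11]).localTamagawaNumber ℤ_[11]))
    (hr : W.analyticRank ≤ 1) {s : ℚ} (hs : shaAn W = (s : ℂ)) (hv : padicValRat 11 s = 0) :
    BSDp W 11 :=
  bsdp_of_jetRowCarrierMult_of_serreWitnesses 11 (by norm_num : Nat.Prime 11) (by norm_num) 1 1 0 1070449 (-830313724)
    (by decide +kernel) [(11, 1, 11), (1097, 1, 3)]
    (by intro t ht; simp only [List.mem_cons, List.not_mem_nil, or_false] at ht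
        rcases ht with rfl | rfl <;> norm_num)
    (by decide +kernel) (by decide +kernel) (by decide +kernel) (by decide +kernel)
    3 5 5 (by norm_num) (by norm_num) (by norm_num) (by norm_num) (by norm_num) (by norm_num)
    (by norm_num) (by norm_num) (by norm_num) (by decide +kernel) (by decide +kernel) (by decide +kernel)
    (n₁ := 2) (n₂ := 8) (n₃ := 8) (by decide +kernel) (by decide +kernel) (by decide +kernel)
    (by decide +kernel) (by decide +kernel) (by decide +kernel) hJ hMcU hGZK hKo hrec hD36 hlev W hW hK
    hD3 hD4 hH hP hnt hI hr hs hv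

/-- **`BSD(E,13)` for `132457c1`, bucket B-mult at `p = 13 ≥ 5`, road S** (`N = 132457`, `r = 1`, split
`I13` at `13`, `c_13 = 13`, `D = -43`; model `[0,0,1,1610801,1595426565]`, `Δ = -1367095546253330356931`, support
`13:13;23:1;443:2`): kit `JET.bsdp_of_jetRowCarrierMult_of_serreWitnesses` with Serre's Prop. 19 triple: `(3, 7)` split
(non-zero square discriminant), `(5, 9)` non-split, `(3, 7)` with `u = 3` (kit table
`HOME/sheets/pv2-B5-witness/witness_B_p5plus.tsv`, job j263826). Displayed binders: `hJ` (READING K3), the published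
`hMcU` … `hlev`, the Heegner datum and the index line at the carrier `13`. CONDITIONAL; nothing booked.
[cite: Jetchev2008, Cor. 1.5 (p. 812)] [cite: Cremona2006, Table 1 (label 132457c1)] [cite: Serre1972, §2.8 Prop. 19] -/
theorem bsdp_jetBmult_132457c1_13_serre
    (hJ : JetchevDivisibilityCarrierMult)
    (hMcU : McCallum1991_padicValNat_card_sha_primary_add_le_of_globalDivisibility)
    (hGZK : rank_eq_analyticRank_of_analyticRank_le_one)
    (hKo : ∀ (N : ℕ) [NeZero N] (W : WeierstrassCurve ℚ) (K : Type) [Field K] [NumberField K],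
      kolyvagin N W K)
    (hrec : ∀ (N : ℕ) [NeZero N] (W : WeierstrassCurve ℚ) (K : Type) [Field K] [NumberField K],
      heegnerPointOfConductor_one_galoisConj N W K)
    (hD36 : ∀ (N : ℕ) [NeZero N] (W : WeierstrassCurve ℚ) (K : Type) [Field K] [NumberField K],
      phi_heegnerTau_mem_singularModuliField N W K)
    (hlev : ∀ {N : ℕ} [NeZero N], IsNewformOf.level_eq_conductorNorm (N := N))
    (W : WeierstrassCurve ℚ) (hW : W = ⟨0, 0, 1, 1610801, 1595426565⟩)
    {N : ℕ} [NeZero N] {K : Type} [Field K] [NumberField K] (hK : IsImaginaryQuadratic K)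
    (hD3 : NumberField.discr K ≠ -3) (hD4 : NumberField.discr K ≠ -4)
    (hH : SatisfiesHeegnerHypothesis N K) {P : (W.baseChange K).toAffine.Point}
    (hP : IsHeegnerPoint N W K P) (hnt : ¬ IsOfFinAddOrder P)
    (hI : padicValNat 13 (AddSubgroup.zmultiples P).index ≤
      padicValNat 13 ((W.baseChange ℚ_[13]).localTamagawaNumber ℤ_[13]))
    (hr : W.analyticRank ≤ 1) {s : ℚ} (hs : shaAn W = (s : ℂ)) (hv : padicValRat 13 s = 0) :
    BSDp W 13 :=
  bsdp_of_jetRowCarrierMult_of_serreWitnesses 13 (by norm_num : Nat.Prime 13) (by norm_num) 0 0 1 1610801 1595426565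
    (by decide +kernel) [(13, 1, 13), (23, 1, 1), (443, 1, 2)]
    (by intro t ht; simp only [List.mem_cons, List.not_mem_nil, or_false] at ht
        rcases ht with rfl | rfl | rfl <;> norm_num)
    (by decide +kernel) (by decide +kernel) (by decide +kernel) (by decide +kernel)
    3 5 3 (by norm_num) (by norm_num) (by norm_num) (by norm_num) (by norm_num) (by norm_num)
    (by norm_num) (by norm_num) (by norm_num) (by decide +kernel) (by decide +kernel) (by decide +kernel)
    (n₁ := 7) (n₂ := 9) (n₃ := 7) (by decide +kernel) (by decide +kernel) (by decide +kernel)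
    (by decide +kernel) (by decide +kernel) (by decide +kernel) hJ hMcU hGZK hKo hrec hD36 hlev W hW hK
    hD3 hD4 hH hP hnt hI hr hs hv

/-- **`BSD(E,17)` for `181152o1`, bucket B-mult at `p = 17 ≥ 5`, road S** (`N = 181152`, `r = 1`, split
`I17` at `17`, `c_17 = 17`, `D = -47`; model `[0,0,0,2030672328,149140196190992]`, `Δ = -10144808246511525605196720254976`, support
`2:12;3:7;17:17;37:2`): kit `JET.bsdp_of_jetRowCarrierMult_of_serreWitnesses` with Serre's Prop. 19 triple: `(5, 5)` split
(non-zero square discriminant), `(7, 4)` non-split, `(5, 5)` with `u = 7` (kit table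
`HOME/sheets/pv2-B5-witness/witness_B_p5plus.tsv`, job j263826). Displayed binders: `hJ` (READING K3), the published
`hMcU` … `hlev`, the Heegner datum and the index line at the carrier `17`. CONDITIONAL; nothing booked.
[cite: Jetchev2008, Cor. 1.5 (p. 812)] [cite: Cremona2006, Table 1 (label 181152o1)] [cite: Serre1972, §2.8 Prop. 19] -/
theorem bsdp_jetBmult_181152o1_17_serre
    (hJ : JetchevDivisibilityCarrierMult)
    (hMcU : McCallum1991_padicValNat_card_sha_primary_add_le_of_globalDivisibility)
    (hGZK : rank_eq_analyticRank_of_analyticRank_le_one)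
    (hKo : ∀ (N : ℕ) [NeZero N] (W : WeierstrassCurve ℚ) (K : Type) [Field K] [NumberField K],
      kolyvagin N W K)
    (hrec : ∀ (N : ℕ) [NeZero N] (W : WeierstrassCurve ℚ) (K : Type) [Field K] [NumberField K],
      heegnerPointOfConductor_one_galoisConj N W K)
    (hD36 : ∀ (N : ℕ) [NeZero N] (W : WeierstrassCurve ℚ) (K : Type) [Field K] [NumberField K],
      phi_heegnerTau_mem_singularModuliField N W K)
    (hlev : ∀ {N : ℕ} [NeZero N], IsNewformOf.level_eq_conductorNorm (N := N))
    (W : WeierstrassCurve ℚ) (hW : W = ⟨0, 0, 0, 2030672328, 149140196190992⟩)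
    {N : ℕ} [NeZero N] {K : Type} [Field K] [NumberField K] (hK : IsImaginaryQuadratic K)
    (hD3 : NumberField.discr K ≠ -3) (hD4 : NumberField.discr K ≠ -4)
    (hH : SatisfiesHeegnerHypothesis N K) {P : (W.baseChange K).toAffine.Point}
    (hP : IsHeegnerPoint N W K P) (hnt : ¬ IsOfFinAddOrder P)
    (hI : padicValNat 17 (AddSubgroup.zmultiples P).index ≤
      padicValNat 17 ((W.baseChange ℚ_[17]).localTamagawaNumber ℤ_[17]))
    (hr : W.analyticRank ≤ 1) {s : ℚ} (hs : shaAn W = (s : ℂ)) (hv : padicValRat 17 s = 0) :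
    BSDp W 17 :=
  bsdp_of_jetRowCarrierMult_of_serreWitnesses 17 (by norm_num : Nat.Prime 17) (by norm_num) 0 0 0 2030672328 149140196190992
    (by decide +kernel) [(2, 5, 12), (3, 2, 7), (17, 1, 17), (37, 1, 2)]
    (by intro t ht; simp only [List.mem_cons, List.not_mem_nil, or_false] at ht
        rcases ht with rfl | rfl | rfl | rfl <;> norm_num)
    (by decide +kernel) (by decide +kernel) (by decide +kernel) (by decide +kernel)
    5 7 5 (by norm_num) (by norm_num) (by norm_num) (by norm_num) (by norm_num) (by norm_num)
    (by norm_num) (by norm_num) (by norm_num) (by decide +kernel) (by decide +kernel) (by decide +kernel)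
    (n₁ := 5) (n₂ := 4) (n₃ := 5) (by decide +kernel) (by decide +kernel) (by decide +kernel)
    (by decide +kernel) (by decide +kernel) (by decide +kernel) hJ hMcU hGZK hKo hrec hD36 hlev W hW hK
    hD3 hD4 hH hP hnt hI hr hs hv

/-- **`BSD(E,5)` for `530c1`, bucket B-mult at `p = 5`, road O** (`N = 530`, `r = 1`, split
`I10` at `5`, `c_5 = 10`, `D = -271`; model `[1,-1,0,1226,30580]`, `Δ = -530000000000`): kit
`JET.bsdp_of_jetRowCarrierMult_of_irr_of_order` with witnesses irr `(3, 7)`, order-`5` `(31, 40)` (kit table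
`HOME/sheets/pv2-B5-witness/witness_B_p5plus.tsv`, job j263826). Displayed binders as above. CONDITIONAL; nothing booked.
[cite: Jetchev2008, Cor. 1.5 (p. 812)] [cite: Cremona2006, Table 1 (label 530c1)] [cite: Serre1972, §2.4 Prop. 15] -/
theorem bsdp_jetBmult_530c1_5_order
    (hJ : JetchevDivisibilityCarrierMult)
    (hMcU : McCallum1991_padicValNat_card_sha_primary_add_le_of_globalDivisibility)
    (hGZK : rank_eq_analyticRank_of_analyticRank_le_one)
    (hKo : ∀ (N : ℕ) [NeZero N] (W : WeierstrassCurve ℚ) (K : Type) [Field K] [NumberField K],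
      kolyvagin N W K)
    (hrec : ∀ (N : ℕ) [NeZero N] (W : WeierstrassCurve ℚ) (K : Type) [Field K] [NumberField K],
      heegnerPointOfConductor_one_galoisConj N W K)
    (hD36 : ∀ (N : ℕ) [NeZero N] (W : WeierstrassCurve ℚ) (K : Type) [Field K] [NumberField K],
      phi_heegnerTau_mem_singularModuliField N W K)
    (hlev : ∀ {N : ℕ} [NeZero N], IsNewformOf.level_eq_conductorNorm (N := N))
    (W : WeierstrassCurve ℚ) (hW : W = ⟨1, (-1), 0, 1226, 30580⟩)
    {N : ℕ} [NeZero N] {K : Type} [Field K] [NumberField K] (hK : IsImaginaryQuadratic K)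
    (hD3 : NumberField.discr K ≠ -3) (hD4 : NumberField.discr K ≠ -4)
    (hH : SatisfiesHeegnerHypothesis N K) {P : (W.baseChange K).toAffine.Point}
    (hP : IsHeegnerPoint N W K P) (hnt : ¬ IsOfFinAddOrder P)
    (hI : padicValNat 5 (AddSubgroup.zmultiples P).index ≤
      padicValNat 5 ((W.baseChange ℚ_[5]).localTamagawaNumber ℤ_[5]))
    (hr : W.analyticRank ≤ 1) {s : ℚ} (hs : shaAn W = (s : ℂ)) (hv : padicValRat 5 s = 0) :
    BSDp W 5 :=
  bsdp_of_jetRowCarrierMult_of_irr_of_order 5 Nat.prime_five (by norm_num) 1 (-1) 0 1226 30580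
    (by decide +kernel) [(2, 1, 10), (5, 1, 10), (53, 1, 1)]
    (by intro t ht; simp only [List.mem_cons, List.not_mem_nil, or_false] at ht
        rcases ht with rfl | rfl | rfl <;> norm_num)
    (by decide +kernel) (by decide +kernel) (by decide +kernel) (by decide +kernel)
    3 31 (by norm_num) (by norm_num) (by norm_num) (by norm_num) (by norm_num) (by norm_num)
    (by decide +kernel) (by decide +kernel) (n₁ := 7) (n₂ := 40) (by decide +kernel)
    (by decide +kernel) (by decide) (by decide) hJ hMcU hGZK hKo hrec hD36 hlev W hW hK hD3 hD4 hH hP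
    hnt hI hr hs hv

/-- **`BSD(E,7)` for `3752l1`, bucket B-mult, road R** (`N = 3752`, `r = 1`, split `I7` at `7`,
`c_7 = 7`, `D = -311`; model `[0,1,0,-13196,579056]`, `Δ = 14125409536`, support `2:8;7:7;67:1`): kit
`JET.bsdp_of_jetRowCarrierMult_of_ram` with the Frobenius witness irr `(3, 3)` and the (ram) witness
`m = 67`, `67^1 ∥ Δ`, `7 ∤ 1` (kit table `HOME/sheets/pv2-B5-witness/witness_B_p5plus.tsv`, job j263826). Displayed binders: `hJ` (READING K3), the
published `hMcU` … `hlev`, the Heegner datum and the index line at the carrier `7`. CONDITIONAL; nothing booked.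
[cite: Jetchev2008, Cor. 1.5 (p. 812)] [cite: Cremona2006, Table 1 (label 3752l1)] -/
theorem bsdp_jetBmult_3752l1_7_ram
    (hJ : JetchevDivisibilityCarrierMult)
    (hMcU : McCallum1991_padicValNat_card_sha_primary_add_le_of_globalDivisibility)
    (hGZK : rank_eq_analyticRank_of_analyticRank_le_one)
    (hKo : ∀ (N : ℕ) [NeZero N] (W : WeierstrassCurve ℚ) (K : Type) [Field K] [NumberField K],
      kolyvagin N W K)
    (hrec : ∀ (N : ℕ) [NeZero N] (W : WeierstrassCurve ℚ) (K : Type) [Field K] [NumberField K],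
      heegnerPointOfConductor_one_galoisConj N W K)
    (hD36 : ∀ (N : ℕ) [NeZero N] (W : WeierstrassCurve ℚ) (K : Type) [Field K] [NumberField K],
      phi_heegnerTau_mem_singularModuliField N W K)
    (hlev : ∀ {N : ℕ} [NeZero N], IsNewformOf.level_eq_conductorNorm (N := N))
    (W : WeierstrassCurve ℚ) (hW : W = ⟨0, 1, 0, (-13196), 579056⟩)
    {N : ℕ} [NeZero N] {K : Type} [Field K] [NumberField K] (hK : IsImaginaryQuadratic K)
    (hD3 : NumberField.discr K ≠ -3) (hD4 : NumberField.discr K ≠ -4)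
    (hH : SatisfiesHeegnerHypothesis N K) {P : (W.baseChange K).toAffine.Point}
    (hP : IsHeegnerPoint N W K P) (hnt : ¬ IsOfFinAddOrder P)
    (hI : padicValNat 7 (AddSubgroup.zmultiples P).index ≤
      padicValNat 7 ((W.baseChange ℚ_[7]).localTamagawaNumber ℤ_[7]))
    (hr : W.analyticRank ≤ 1) {s : ℚ} (hs : shaAn W = (s : ℂ)) (hv : padicValRat 7 s = 0) :
    BSDp W 7 :=
  bsdp_of_jetRowCarrierMult_of_ram 7 (by norm_num : Nat.Prime 7) (by norm_num) 0 1 0 (-13196) 579056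
    (by decide +kernel) [(2, 3, 8), (7, 1, 7), (67, 1, 1)]
    (by intro t ht; simp only [List.mem_cons, List.not_mem_nil, or_false] at ht
        rcases ht with rfl | rfl | rfl <;> norm_num)
    (by decide +kernel) (by decide +kernel) (by decide +kernel) (by decide +kernel)
    3 (by norm_num) (by norm_num) (by norm_num) (by decide +kernel) (n := 3) (by decide +kernel)
    (by decide) 67 (by norm_num) (by norm_num) (by decide +kernel) (by decide +kernel) (e := 1)
    (by decide +kernel) (by decide +kernel) (by norm_num) hJ hMcU hGZK hKo hrec hD36 hlev W hW hK hD3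
    hD4 hH hP hnt hI hr hs hv

end Summit.BirchSwinnertonDyer.Rank1Residual.JET

end
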